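import Summits.CriticalPhenomena.PercolationContinuityZ3.Theorems.SahiLebesgueCubeCumulations
import Summits.CriticalPhenomena.PercolationContinuityZ3.Theorems.SahiLiebSahiRectanglesProduct

/-!
# Two free slots and `min`-type functions: Lebesgue and every product probability measure on `[0,1]^d`, every `n`
# (cell `prim-sahi`, typer seat; `--supports stmt-CriticalPhenomena-4575`)

Sequel of `SahiLebesgueCubeCumulations.lean` (Blinovsky's theorem with two free slots for Lebesgue measure on `Q_d`, the
constrained slots having principal up-box level sets `[a_1,1] × ⋯ × [a_d,1]`).  Here the constrained class is enlarged to
the nonnegative functions ALL OF WHOSE UPPER LEVEL SETS ARE PRODUCTS OF COORDINATE UP-SETS `{x | ∀ j, x_j ∈ U_j}` (`U_j`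
up-sets of `[0,1]`, i.e. intervals `[a,1]`, `(a,1]`, `∅`, `[0,1]`) — exactly the functions `x ↦ min_j g_j(x_j)` with
`g_j ≥ 0` increasing —, a class stable under every coordinatewise monotone change of variables; whence the same theorem
for EVERY PRODUCT PROBABILITY MEASURE on `Q_d` by the quantile transform (`SahiRectangles.measurePreserving_quantilePi`).

* `loCube_preimage_prodUpperSet` — products of coordinate up-sets pull back to principal up-sets of the grid `[m+1]^d`
  (or to `∅`) under the lower-corner map.
* **`msahiE_volume_nonneg_prodUpperLevelSets_offTwo`** — Lebesgue measure on `Q_d`, every `n`: two free nonnegative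
  increasing slots, the others nonnegative with product-of-up-sets upper level sets (or empty) ⟹ `E_n ≥ 0`.  No measurability or
  boundedness hypotheses.  **`msahiE_volume_nonneg_prodLowerLevelSets_offTwo`** — reflected form (two free decreasing
  slots; products of coordinate down-sets, e.g. rectangles `[0,r_1⟩ × ⋯ × [0,r_d⟩` with each side closed or open).
* **`msahiE_pi_nonneg_prodUpperLevelSets_offTwo`** — the same for every product probability measure `⊗_j μ_j` on `Q_d`
  (free slots measurable).  **`msahiE_pi_nonneg_prodLowerLevelSets_offTwo`** — reflected form.

New mathematics; ingredients [Sahi2008, Thm. 2], [Blinovsky2013], [LiebSahi2021, Lemmas 2.2, 2.3, 3.8, Cor. 3.6].  No conjecture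
enters; no definitions; axioms standard.
-/

namespace Summit.CriticalPhenomena.PercolationContinuityZ3.Theorems

open MeasureTheory Set Filter Topology Literature.Combinatorics.Sahi2008
open Literature.Combinatorics.Sahi2008.LebesgueCube Literature.Probability.LatticeModels
open scoped unitInterval

namespace SahiLebesgueCumulations

variable {d : ℕ}

/-! ### Functions with product-of-up-sets level sets -/

/-- A product of coordinate up-sets is an up-set of `Q_d`. [folklore] -/
theorem isUpperSet_prodUpperSet {U : Fin d → Set I} (hU : ∀ j, IsUpperSet (U j)) :
    IsUpperSet {x : Fin d → I | ∀ j, x j ∈ U j} :=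
  fun _ _ hle hx j => hU j (hle j) (hx j)

/-- **A nonnegative function all of whose upper level sets are products of coordinate up-sets is increasing.** [folklore] -/
theorem monotone_of_prodUpperLevelSets {φ : (Fin d → I) → ℝ} (h0 : ∀ x, 0 ≤ φ x)
    (hlev : ∀ t : ℝ, 0 ≤ t →
      (∃ U : Fin d → Set I, (∀ j, IsUpperSet (U j)) ∧ {x | t < φ x} = {x | ∀ j, x j ∈ U j}) ∨ {x | t < φ x} = ∅) :
    Monotone φ := by
  intro x y hxy
  by_contra hlt
  push Not at hlt
  have hx : x ∈ ({z | φ y < φ z} : Set (Fin d → I)) := hlt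
  rcases hlev (φ y) (h0 y) with ⟨U, hU, hUeq⟩ | hempty
  · rw [hUeq] at hx
    have hy : y ∈ ({z | ∀ j, z j ∈ U j} : Set (Fin d → I)) := isUpperSet_prodUpperSet hU hxy hx
    rw [← hUeq, Set.mem_setOf_eq] at hy
    exact lt_irrefl _ hy
  · rw [hempty] at hx
    exact hx

/-- A product of coordinate up-sets of `[0,1]` is Borel (each factor is an interval). [folklore] -/
theorem measurableSet_prodUpperSet {U : Fin d → Set I} (hU : ∀ j, IsUpperSet (U j)) :
    MeasurableSet {x : Fin d → I | ∀ j, x j ∈ U j} := by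
  have e : {x : Fin d → I | ∀ j, x j ∈ U j} = ⋂ j, (fun x : Fin d → I => x j) ⁻¹' U j := by
    ext x; simp
  rw [e]
  exact MeasurableSet.iInter fun j => measurable_pi_apply j (hU j).ordConnected.measurableSet

/-- **A nonnegative function with product-of-up-sets upper level sets is Borel measurable.** [folklore] -/
theorem measurable_of_prodUpperLevelSets {φ : (Fin d → I) → ℝ} (h0 : ∀ x, 0 ≤ φ x)
    (hlev : ∀ t : ℝ, 0 ≤ t →
      (∃ U : Fin d → Set I, (∀ j, IsUpperSet (U j)) ∧ {x | t < φ x} = {x | ∀ j, x j ∈ U j}) ∨ {x | t < φ x} = ∅) :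
    Measurable φ := by
  refine measurable_of_Ioi fun t => ?_
  change MeasurableSet {x | t < φ x}
  by_cases ht : 0 ≤ t
  · rcases hlev t ht with ⟨U, hU, hUeq⟩ | hempty
    · rw [hUeq]
      exact measurableSet_prodUpperSet hU
    · rw [hempty]
      exact MeasurableSet.empty
  · have e : {x | t < φ x} = Set.univ := Set.eq_univ_of_forall fun x => lt_of_lt_of_le (lt_of_not_ge ht) (h0 x)
    rw [e]
    exact MeasurableSet.univ

/-! ### The grid -/

/-- **Products of coordinate up-sets pull back to principal up-sets of the grid (or to the empty set)** under the
lower-corner map `loCube m : [m+1]^d → Q_d`. [folklore] -/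
theorem loCube_preimage_prodUpperSet (m : ℕ) {U : Fin d → Set I} (hU : ∀ j, IsUpperSet (U j)) :
    (∃ b : Fin d → Fin (m + 1), {c : Fin d → Fin (m + 1) | ∀ j, loCube m c j ∈ U j} = {c | b ≤ c}) ∨
      {c : Fin d → Fin (m + 1) | ∀ j, loCube m c j ∈ U j} = ∅ := by
  classical
  have hcoord : ∀ (c : Fin d → Fin (m + 1)) (j : Fin d), loCube m c j = loCube m (fun _ => c j) j :=
    fun c j => rfl
  have hmono1 : ∀ (j : Fin d) (u v : Fin (m + 1)), u ≤ v →
      loCube m (fun _ : Fin d => u) j ≤ loCube m (fun _ => v) j :=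
    fun j u v huv => loCube_mono m (fun _ => huv) j
  by_cases hsat : ∀ j, ∃ u : Fin (m + 1), loCube m (fun _ : Fin d => u) j ∈ U j
  · refine Or.inl ?_
    have hne : ∀ j, (Finset.univ.filter fun u : Fin (m + 1) => loCube m (fun _ : Fin d => u) j ∈ U j).Nonempty :=
      fun j => by
        obtain ⟨u, hu⟩ := hsat j
        exact ⟨u, Finset.mem_filter.2 ⟨Finset.mem_univ u, hu⟩⟩
    refine ⟨fun j => (Finset.univ.filter fun u : Fin (m + 1) => loCube m (fun _ : Fin d => u) j ∈ U j).min' (hne j),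
      Set.ext fun c => ?_⟩
    simp only [Set.mem_setOf_eq]
    constructor
    · intro h j
      exact Finset.min'_le _ _ (Finset.mem_filter.2 ⟨Finset.mem_univ _, (hcoord c j) ▸ h j⟩)
    · intro h j
      have hmem := Finset.min'_mem _ (hne j)
      rw [Finset.mem_filter] at hmem
      rw [hcoord c j]
      exact hU j (hmono1 j _ _ (h j)) hmem.2
  · refine Or.inr (Set.eq_empty_of_forall_notMem fun c hc => hsat fun j => ⟨c j, ?_⟩)
    rw [← hcoord c j]
    exact hc j

/-! ### Lebesgue measure -/

/-- **Two free slots and `min`-type cumulations, Lebesgue measure on `[0,1]^d`, every `n`.**  If the `f_k`, `k ∈ J`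
(`|J| ≤ 2`), are arbitrary nonnegative increasing functions on `Q_d` and every other `f_k` is a nonnegative function all of
whose upper level sets `{f_k > t}` (`t ≥ 0`) are products of coordinate up-sets `{x | ∀ j, x_j ∈ U_j}` (i.e.
`f_k(x) = min_j g_{kj}(x_j)`-type functions), then `0 ≤ E_n(f_0,…,f_{n−1})` for Lebesgue measure.
[this work; cite: Sahi2008, Thm. 2; Blinovsky2013; LiebSahi2021, Lemmas 2.2, 2.3, 3.8] -/
theorem msahiE_volume_nonneg_prodUpperLevelSets_offTwo {n : ℕ} (J : Finset (Fin n)) (hJ : J.card ≤ 2)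
    (f : Fin n → (Fin d → I) → ℝ) (hf0 : ∀ k x, 0 ≤ f k x) (hmono : ∀ k, k ∈ J → Monotone (f k))
    (hlev : ∀ k, k ∉ J → ∀ t : ℝ, 0 ≤ t →
      (∃ U : Fin d → Set I, (∀ j, IsUpperSet (U j)) ∧ {x | t < f k x} = {x | ∀ j, x j ∈ U j}) ∨
        {x | t < f k x} = ∅) :
    0 ≤ msahiE (volume : Measure (Fin d → I)) n f := by
  classical
  have hmono' : ∀ k, Monotone (f k) := fun k => by
    by_cases hk : k ∈ J
    · exact hmono k hk
    · exact monotone_of_prodUpperLevelSets (hf0 k) (hlev k hk)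
  set B : ℝ := ∑ k, f k fun _ => 1 with hB
  have hbd : ∀ k x, f k x ≤ B := fun k x =>
    (hmono' k fun j => unitInterval.le_one (x j)).trans
      (Finset.single_le_sum (f := fun k => f k fun _ => 1) (fun k _ => hf0 k _) (Finset.mem_univ k))
  set M : Finset (Fin n) → ℝ := fun S => ∫ x, (∏ i ∈ S, f i) x ∂volume with hM
  have hE : msahiE (volume : Measure (Fin d → I)) n f = momentE n M := msahiE_eq_momentE _ n f
  have hlim : Tendsto (fun m => momentE n fun S => ex (cubeWeight d m) (∏ i ∈ S, gridFam m f i))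
      atTop (𝓝 (momentE n M)) :=
    ((continuous_momentE n).tendsto M).comp (tendsto_pi_nhds.2 fun S => tendsto_gridMoment hf0 hmono' S)
  rw [hE]
  refine ge_of_tendsto' hlim fun m => ?_
  rw [← sahiE_eq_momentE, ← msahiE_weightMeasure cubeWeight_nonneg]
  let 𝒮 : Fin n → Set (Set (Fin d → Fin (m + 1))) := fun k =>
    if k ∈ J then {U | IsUpperSet U} else {A | ∃ b : Fin d → Fin (m + 1), A = {c | b ≤ c}}
  have h𝒮up : ∀ k, ∀ A ∈ 𝒮 k, IsUpperSet A := by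
    intro k A hA
    by_cases hk : k ∈ J
    · simp only [𝒮, hk, if_true, Set.mem_setOf_eq] at hA
      exact hA
    · simp only [𝒮, hk, if_false, Set.mem_setOf_eq] at hA
      obtain ⟨b, rfl⟩ := hA
      exact fun _ _ hle hb => hb.trans hle
  refine msahiE_nonneg_of_levelSets_slotwise (weightMeasure (cubeWeight d m)) 𝒮 (fun k A _ => measurableSet_grid A)
    (fun A hA => ?_) (gridFam m f) (gridFam_nonneg hf0 m) (B := B) (fun k c => hbd k _) fun k t ht => ?_
  · rw [msahiE_weightMeasure cubeWeight_nonneg]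
    have hex : ∀ k, ∃ b : Fin d → Fin (m + 1), k ∉ J → A k = {c | b ≤ c} := by
      intro k
      by_cases hk : k ∈ J
      · exact ⟨fun _ => 0, fun h => absurd hk h⟩
      · have h := hA k
        simp only [𝒮, hk, if_false, Set.mem_setOf_eq] at h
        obtain ⟨b, h⟩ := h
        exact ⟨b, fun _ => h⟩
    choose b hb using hex
    refine sahiE_nonneg_of_isLatticeCumulation_offTwo (isFKGMeasure_cubeWeight d m) _
      (fun k c => Set.indicator_nonneg (fun _ _ => zero_le_one) c)
      (fun k => SahiInfiniteVolume.monotone_indicator_one_of_isUpperSet (h𝒮up k _ (hA k))) J hJ fun k hk => ?_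
    have heq : (A k).indicator (1 : (Fin d → Fin (m + 1)) → ℝ) = setInd (principalUp (b k)) := by
      funext c
      rw [hb k hk, setInd_apply]
      by_cases hc : b k ≤ c
      · rw [if_pos (mem_principalUp.2 hc), Set.indicator_of_mem (show c ∈ {c | b k ≤ c} from hc), Pi.one_apply]
      · rw [if_neg (fun h => hc (mem_principalUp.1 h)),
          Set.indicator_of_notMem (show c ∉ {c | b k ≤ c} from hc)]
    rw [heq]
    exact isLatticeCumulation_setInd_principalUp (b k)
  · by_cases hk : k ∈ J
    · refine Or.inl ?_
      simp only [𝒮, hk, if_true, Set.mem_setOf_eq]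
      exact fun c c' hle hc => lt_of_lt_of_le hc (gridFam_monotone hmono' m k hle)
    · rcases hlev k hk t ht with ⟨U, hU, hUeq⟩ | hempty
      · have hpre : {c : Fin d → Fin (m + 1) | t < gridFam m f k c} = {c | ∀ j, loCube m c j ∈ U j} := by
          ext c
          have : loCube m c ∈ {x | t < f k x} ↔ loCube m c ∈ {x : Fin d → I | ∀ j, x j ∈ U j} := by rw [hUeq]
          exact this
        rcases loCube_preimage_prodUpperSet m hU with ⟨b, hb⟩ | hemp
        · refine Or.inl ?_
          simp only [𝒮, hk, if_false, Set.mem_setOf_eq]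
          exact ⟨b, hpre.trans hb⟩
        · exact Or.inr (hpre.trans hemp)
      · refine Or.inr (Set.eq_empty_of_forall_notMem fun c hc => ?_)
        have : loCube m c ∈ ({x | t < f k x} : Set (Fin d → I)) := hc
        rw [hempty] at this
        exact this

/-- **Reflected form: two free decreasing slots and products of coordinate down-sets** (e.g. rectangles
`[0,r_1⟩ × ⋯ × [0,r_d⟩` with each side closed or open), Lebesgue measure on `[0,1]^d`, every `n`.
[this work; cite: LiebSahi2021, Cor. 3.6 and §2 (change of variables); Sahi2008, Thm. 2; Blinovsky2013] -/
theorem msahiE_volume_nonneg_prodLowerLevelSets_offTwo {n : ℕ} (J : Finset (Fin n)) (hJ : J.card ≤ 2)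
    (f : Fin n → (Fin d → I) → ℝ) (hf0 : ∀ k x, 0 ≤ f k x) (hanti : ∀ k, k ∈ J → Antitone (f k))
    (hlev : ∀ k, k ∉ J → ∀ t : ℝ, 0 ≤ t →
      (∃ L : Fin d → Set I, (∀ j, IsLowerSet (L j)) ∧ {x | t < f k x} = {x | ∀ j, x j ∈ L j}) ∨
        {x | t < f k x} = ∅) :
    0 ≤ msahiE (volume : Measure (Fin d → I)) n f := by
  set ρ : (Fin d → I) → Fin d → I := fun x j => unitInterval.symm (x j) with hρ
  have hmp : MeasurePreserving ρ volume volume := volume_preserving_pi fun _ => unitInterval.measurePreserving_symm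
  have hme : MeasurableEmbedding ρ :=
    (MeasurableEquiv.piCongrRight fun _ : Fin d => unitInterval.symmMeasurableEquiv).measurableEmbedding
  have hρanti : ∀ x y : Fin d → I, x ≤ y → ρ y ≤ ρ x := fun x y hxy j => unitInterval.symm_le_symm.2 (hxy j)
  rw [← msahiE_comp_measurePreserving hmp hme n f]
  refine msahiE_volume_nonneg_prodUpperLevelSets_offTwo J hJ _ (fun k x => hf0 k _)
    (fun k hk x y hxy => hanti k hk (hρanti x y hxy)) fun k hk t ht => ?_
  have h1 : ∀ x, x ∈ ({x | t < (f k ∘ ρ) x} : Set (Fin d → I)) ↔ ρ x ∈ {y | t < f k y} := fun x => Iff.rfl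
  rcases hlev k hk t ht with ⟨L, hL, hLeq⟩ | hempty
  · refine Or.inl ⟨fun j => unitInterval.symm ⁻¹' L j, fun j => ?_, ?_⟩
    · intro u v huv hu
      exact hL j (unitInterval.symm_le_symm.2 huv) hu
    · ext x
      rw [h1, hLeq]
      simp only [Set.mem_setOf_eq, Set.mem_preimage, hρ]
  · refine Or.inr (Set.eq_empty_of_forall_notMem fun x hx => ?_)
    have : ρ x ∈ ({y | t < f k y} : Set (Fin d → I)) := (h1 x).1 hx
    rw [hempty] at this
    exact this

/-! ### Every product probability measure on `Q_d` -/

variable (μ : Fin d → Measure I) [∀ j, IsProbabilityMeasure (μ j)]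

/-- **Two free slots and `min`-type cumulations, for every product probability measure on `[0,1]^d`, every `n`.**
For arbitrary Borel probability measures `μ_j` on `[0,1]`: if the `f_k`, `k ∈ J` (`|J| ≤ 2`), are measurable nonnegative
increasing and every other `f_k` is nonnegative with product-of-up-sets upper level sets, then `0 ≤ E_n(f_0,…,f_{n−1})`
under `⊗_j μ_j` (coordinatewise quantile transform: the class is stable under coordinatewise monotone maps).
[this work; cite: Sahi2008, Thm. 2; Blinovsky2013; LiebSahi2021, Lemmas 2.2, 2.3, 3.8] -/
theorem msahiE_pi_nonneg_prodUpperLevelSets_offTwo {n : ℕ} (J : Finset (Fin n)) (hJ : J.card ≤ 2)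
    (f : Fin n → (Fin d → I) → ℝ) (hf0 : ∀ k x, 0 ≤ f k x) (hfm : ∀ k, k ∈ J → Measurable (f k))
    (hmono : ∀ k, k ∈ J → Monotone (f k))
    (hlev : ∀ k, k ∉ J → ∀ t : ℝ, 0 ≤ t →
      (∃ U : Fin d → Set I, (∀ j, IsUpperSet (U j)) ∧ {x | t < f k x} = {x | ∀ j, x j ∈ U j}) ∨
        {x | t < f k x} = ∅) :
    0 ≤ msahiE (Measure.pi μ) n f := by
  set G : (Fin d → I) → Fin d → I := fun u j => UnitIntervalQuantile.quantile (μ j) (u j) with hG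
  have hGmono : Monotone G := fun u v huv j => UnitIntervalQuantile.quantile_mono (μ j) (huv j)
  have hfm' : ∀ k, Measurable (f k) := fun k => by
    by_cases hk : k ∈ J
    · exact hfm k hk
    · exact measurable_of_prodUpperLevelSets (hf0 k) (hlev k hk)
  rw [← msahiE_comp_measurePreserving_of_measurable (SahiRectangles.measurePreserving_quantilePi μ) n f hfm']
  refine msahiE_volume_nonneg_prodUpperLevelSets_offTwo J hJ _ (fun k u => hf0 k _)
    (fun k hk => (hmono k hk).comp hGmono) fun k hk t ht => ?_
  have h1 : ∀ u, u ∈ ({u | t < (f k ∘ G) u} : Set (Fin d → I)) ↔ G u ∈ {y | t < f k y} := fun u => Iff.rfl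
  rcases hlev k hk t ht with ⟨U, hU, hUeq⟩ | hempty
  · refine Or.inl ⟨fun j => UnitIntervalQuantile.quantile (μ j) ⁻¹' U j, fun j => ?_, ?_⟩
    · intro u v huv hu
      exact hU j (UnitIntervalQuantile.quantile_mono (μ j) huv) hu
    · ext u
      rw [h1, hUeq]
      simp only [Set.mem_setOf_eq, Set.mem_preimage, hG]
  · refine Or.inr (Set.eq_empty_of_forall_notMem fun u hu => ?_)
    have : G u ∈ ({y | t < f k y} : Set (Fin d → I)) := (h1 u).1 hu
    rw [hempty] at this
    exact this

/-- The reflected measures `σ_* μ_j` (`σ(x) = 1 − x`) and the reflection of `Q_d` (plumbing): `σ` pushes `σ_* μ_j` back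
to `μ_j`. [folklore] -/
theorem measurePreserving_symm_map_symm (ν : Measure I) [IsProbabilityMeasure ν] :
    MeasurePreserving unitInterval.symm (ν.map unitInterval.symm) ν := by
  refine ⟨unitInterval.continuous_symm.measurable, ?_⟩
  rw [Measure.map_map unitInterval.continuous_symm.measurable unitInterval.continuous_symm.measurable]
  have e : unitInterval.symm ∘ unitInterval.symm = id := funext unitInterval.symm_symm
  rw [e, Measure.map_id]

/-- **Reflected form for product measures: two free decreasing slots and products of coordinate down-sets**, every
product probability measure on `[0,1]^d`, every `n`. [this work; cite: LiebSahi2021, Cor. 3.6; Sahi2008, Thm. 2; Blinovsky2013] -/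
theorem msahiE_pi_nonneg_prodLowerLevelSets_offTwo {n : ℕ} (J : Finset (Fin n)) (hJ : J.card ≤ 2)
    (f : Fin n → (Fin d → I) → ℝ) (hf0 : ∀ k x, 0 ≤ f k x) (hfm : ∀ k, k ∈ J → Measurable (f k))
    (hanti : ∀ k, k ∈ J → Antitone (f k))
    (hlev : ∀ k, k ∉ J → ∀ t : ℝ, 0 ≤ t →
      (∃ L : Fin d → Set I, (∀ j, IsLowerSet (L j)) ∧ {x | t < f k x} = {x | ∀ j, x j ∈ L j}) ∨
        {x | t < f k x} = ∅) :
    0 ≤ msahiE (Measure.pi μ) n f := by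
  -- reflect: `⊗ μ_j` is the image of `⊗ σ_*μ_j` under the reflection `ρ` of `Q_d`
  set ρ : (Fin d → I) → Fin d → I := fun x j => unitInterval.symm (x j) with hρ
  haveI : ∀ j, IsProbabilityMeasure ((μ j).map unitInterval.symm) := fun j =>
    Measure.isProbabilityMeasure_map unitInterval.continuous_symm.measurable.aemeasurable
  have hmp : MeasurePreserving ρ (Measure.pi fun j => (μ j).map unitInterval.symm) (Measure.pi μ) :=
    measurePreserving_pi (fun j => (μ j).map unitInterval.symm) μ fun j => measurePreserving_symm_map_symm (μ j)
  have hme : MeasurableEmbedding ρ :=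
    (MeasurableEquiv.piCongrRight fun _ : Fin d => unitInterval.symmMeasurableEquiv).measurableEmbedding
  have hρanti : ∀ x y : Fin d → I, x ≤ y → ρ y ≤ ρ x := fun x y hxy j => unitInterval.symm_le_symm.2 (hxy j)
  rw [← msahiE_comp_measurePreserving hmp hme n f]
  refine msahiE_pi_nonneg_prodUpperLevelSets_offTwo _ J hJ _ (fun k x => hf0 k _)
    (fun k hk => (hfm k hk).comp hme.measurable) (fun k hk x y hxy => hanti k hk (hρanti x y hxy))
    fun k hk t ht => ?_
  have h1 : ∀ x, x ∈ ({x | t < (f k ∘ ρ) x} : Set (Fin d → I)) ↔ ρ x ∈ {y | t < f k y} := fun x => Iff.rfl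
  rcases hlev k hk t ht with ⟨L, hL, hLeq⟩ | hempty
  · refine Or.inl ⟨fun j => unitInterval.symm ⁻¹' L j, fun j => ?_, ?_⟩
    · intro u v huv hu
      exact hL j (unitInterval.symm_le_symm.2 huv) hu
    · ext x
      rw [h1, hLeq]
      simp only [Set.mem_setOf_eq, Set.mem_preimage, hρ]
  · refine Or.inr (Set.eq_empty_of_forall_notMem fun x hx => ?_)
    have : ρ x ∈ ({y | t < f k y} : Set (Fin d → I)) := (h1 x).1 hx
    rw [hempty] at this
    exact this

end SahiLebesgueCumulations

end Summit.CriticalPhenomena.PercolationContinuityZ3.Theorems
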